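import Summits.ABC.ABC.Theorems.TwistAmplificationMazurKaneLawSqrtLatticeToolZ
import Summits.ABC.ABC.Theorems.TwistAmplificationMazurKaneLawToolkitTame

-- Summit.ABC.ABC is the mandated summit-side namespace (single-conjunct summit); the lakefile sets the same option tree-wide.
set_option linter.dupNamespace false

/-!
# The two-root tool with host `z` as a law (crux stmt-ABC-2757, stub `stub_twoRootTameZ`)

Stub 3b (`TwoRootTameZLaw`) of the line `critical-kloosterman-powerful-moduli` for the crux
`Summit.ABC.ABC.Theses.TwistAmplification.MazurKaneLaw`. In the shape language of
Bernert–Browning–Lichtman–Teräväinen (`AbcShapes`: `B = shapeCount c₁ c₂ c₃ X Y Z` counts the coprime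
solutions of `c₁ ∏ xⱼ^{j+1} + c₂ ∏ yⱼ^{j+1} = c₃ ∏ zⱼ^{j+1}` in the dyadic boxes; coordinate `i₀ = 0` is the
linear variable, `i₁ = 1` the square level) it says: for data admissible for `(l, ε)`
(`AbcShapes.Admissible`) carrying the R₂ certificate with host `z`,
`P := ∏ᵢ XᵢYᵢZᵢ ≤ 2 R · Z₀X₁Y₁` with `R := C₀^{l-1+3ε}`, one has `B ≤ K · C₀^{l-1+3ε+η}` for every
`η > 0`, with `K` depending on `l, ε, η` and the dimension only.

Proof (`twoRootTameZ_law`, any dimension `M`; the stub is the instance `M = numShapes ε`): the landed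
square-root lattice tool with host `z` (`Summit.ABC.ABC.Theorems.MazurKaneLaw.sqrtLatticeToolZ`) at
`H = {i₀}`, `i = i₁` gives
`B ≤ #fibres · Dτ^{M+3} · (2 + 112 X₁Y₁/(c₃ offVal_{i₀} Z))` with
`#fibres = #subBox_{i₁} X · #subBox_{i₁} Y · #subBox_{i₀} Z = P/(X₁Y₁Z₀)` (`card_subBox_mul`), and
`(c₃ offVal_{i₀} Z) · Z₀ = c₃ shapeVal Z` (`shapeVal_eq_offVal_mul_onVal`, `onVal {i₀} Z = Z₀`). Hence
`B ≤ Dτ^{M+3} (2P/(X₁Y₁Z₀) + 112 P/(c₃ shapeVal Z))`; the first term is `≤ 4R` by the certificate and the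
second is `≤ 112 V₂ P/C₀ ≤ 112 V₂ 2^{l+3ε} R` automatically (`C₀ ≤ V₂ · c₃ shapeVal Z`,
`P ≤ (2C₀)^{l+3ε}`, `V₂ = shapeVal (2,…,2)`). The divisor constant is handled as in
`Summit.ABC.ABC.Theorems.MazurKaneLaw.toolkitTame`: `T = V₂ · 2C₀` bounds every `cⱼ · shapeVal(2·)`,
`Dτ = ⌊C_τ T^κ⌋` with `κ (M+3) = η` (`Literature.NumberTheory.Sieve.exists_card_divisors_le_mul_rpow`),
so `Dτ^{M+3} ≤ C_τ^{M+3} (2V₂)^η C₀^η` and `K = C_τ^{M+3} (2V₂)^η (4 + 112 V₂ 2^{l+3ε})`.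
-/

noncomputable section

open Finset
open Literature.NumberTheory.DiophantineGeometry
open Literature.NumberTheory.DiophantineGeometry.AbcShapes

namespace Summit.ABC.ABC.Theorems.MazurKaneLaw

open Summit.ABC.ABC.Theorems.MazurKaneLaw.Toolkit

/-- **The two-root tool with host `z` as a law, in any dimension `M`.** For `η > 0` there is `K ≥ 0`
(depending on `M, l, ε, η`) such that every datum admissible for `(l, ε)` with
`∏ᵢ XᵢYᵢZᵢ ≤ 2 C₀^{l-1+3ε} · Z_{i₀} X_{i₁} Y_{i₁}` (`i₀ = 0`, `i₁ = 1`) has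
`B_M ≤ K · C₀^{l-1+3ε+η}`: the square-root lattice tool `sqrtLatticeToolZ` at `H = {i₀}`, `i = i₁`,
`#fibres · X₁Y₁Z₀ = P`, `(c₃ offVal_{i₀} Z) Z₀ = c₃ shapeVal Z ≥ C₀/V₂`, `P ≤ (2C₀)^{l+3ε}`, and the
divisor bound `Dτ^{M+3} ≤ C_τ^{M+3} (2V₂ C₀)^η` for `T = V₂ · 2C₀`, `κ(M+3) = η`. [folklore] -/
theorem twoRootTameZ_law (M : ℕ) (l ε : ℝ) {η : ℝ} (hη : 0 < η) :
    ∃ K : ℝ, 0 ≤ K ∧ ∀ (C₀ c₁ c₂ c₃ : ℕ) (X Y Z : Fin M → ℕ) (i₀ i₁ : Fin M),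
      (i₀ : ℕ) = 0 → (i₁ : ℕ) = 1 → Admissible l ε C₀ c₁ c₂ c₃ X Y Z →
        (∏ i, ((X i : ℝ) * Y i * Z i)) ≤ 2 * (C₀ : ℝ) ^ (l - 1 + 3 * ε) * ((Z i₀ : ℝ) * X i₁ * Y i₁) →
          (shapeCount c₁ c₂ c₃ X Y Z : ℝ) ≤ K * (C₀ : ℝ) ^ (l - 1 + 3 * ε + η) := by
  classical
  -- the constants `V₂`, `κ = η/(M+3)`, `C_τ`, `E = 4 + 112 V₂ 2^{l+3ε}`, `K`
  obtain ⟨V2, hV2⟩ : ∃ V : ℕ, V = shapeVal (fun _ : Fin M => 2) := ⟨_, rfl⟩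
  have hV2pos : 0 < V2 := by rw [hV2]; exact shapeVal_pos fun _ => two_pos
  have hV2r : (0 : ℝ) < V2 := by exact_mod_cast hV2pos
  obtain ⟨κ, hκ⟩ : ∃ κ : ℝ, κ = η / ((M : ℝ) + 3) := ⟨_, rfl⟩
  have hκ0 : 0 < κ := by rw [hκ]; positivity
  have hκn : κ * ((M + 3 : ℕ) : ℝ) = η := by
    rw [hκ]; push_cast; exact div_mul_cancel₀ _ (by positivity)
  obtain ⟨Cτ, hCτ1, hCτ⟩ := Literature.NumberTheory.Sieve.exists_card_divisors_le_mul_rpow hκ0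
  have hCτ0 : 0 < Cτ := by linarith
  obtain ⟨E, hE⟩ : ∃ E : ℝ, E = 4 + 112 * (V2 : ℝ) * (2 : ℝ) ^ (l + 3 * ε) := ⟨_, rfl⟩
  have hE0 : 0 < E := by rw [hE]; positivity
  obtain ⟨K, hK⟩ : ∃ K : ℝ, K = Cτ ^ (M + 3) * (2 * (V2 : ℝ)) ^ η * E := ⟨_, rfl⟩
  have hK0 : 0 ≤ K := by rw [hK]; positivity
  refine ⟨K, hK0, fun C₀ c₁ c₂ c₃ X Y Z i₀ i₁ hi₀ hi₁ hA hcert => ?_⟩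
  obtain ⟨hC₀1, hc₁, hc₂, hc₃, -, -, -, hXp, hYp, hZp, hPle, hvX, hvY, hvZ, hC₀le⟩ := hA
  have hC₀ : (1 : ℝ) ≤ C₀ := by exact_mod_cast hC₀1
  have hC₀0 : (0 : ℝ) < C₀ := by linarith
  -- `T = V₂ · 2C₀`, `Dτ = ⌊C_τ T^κ⌋`
  obtain ⟨T, hT⟩ : ∃ T : ℕ, T = V2 * (2 * C₀) := ⟨_, rfl⟩
  have hT' : (T : ℝ) = 2 * (V2 : ℝ) * C₀ := by rw [hT]; push_cast; ring
  have hTval : ∀ {c : ℕ} {W : Fin M → ℕ}, c * shapeVal W ≤ 2 * C₀ →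
      c * shapeVal (fun i => 2 * W i) ≤ T := by
    intro c W hW
    calc c * shapeVal (fun i => 2 * W i) = V2 * (c * shapeVal W) := by
          rw [show (fun i => 2 * W i) = fun i => (fun _ : Fin M => 2) i * W i from rfl,
            shapeVal_mul, ← hV2]; ring
      _ ≤ V2 * (2 * C₀) := Nat.mul_le_mul_left _ hW
      _ = T := hT.symm
  obtain ⟨Dτ, hDτ⟩ : ∃ D : ℕ, D = ⌊Cτ * (T : ℝ) ^ κ⌋₊ := ⟨_, rfl⟩
  have hD : ∀ n : ℕ, n ≠ 0 → n ≤ T → n.divisors.card ≤ Dτ := by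
    intro n hn hnT
    rw [hDτ]
    refine Nat.le_floor ((hCτ n hn).trans ?_)
    exact mul_le_mul_of_nonneg_left (Real.rpow_le_rpow (Nat.cast_nonneg _)
      (by exact_mod_cast hnT) hκ0.le) hCτ0.le
  have hDreal : (Dτ : ℝ) ≤ Cτ * (T : ℝ) ^ κ := by rw [hDτ]; exact Nat.floor_le (by positivity)
  -- `Dτ^{M+3} ≤ C_τ^{M+3} (2V₂)^η C₀^η`
  have hDpow : (Dτ : ℝ) ^ (M + 3) ≤ Cτ ^ (M + 3) * (2 * (V2 : ℝ)) ^ η * (C₀ : ℝ) ^ η := by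
    have hTpow : ((T : ℝ) ^ κ) ^ (M + 3) = (2 * (V2 : ℝ)) ^ η * (C₀ : ℝ) ^ η := by
      rw [← Real.rpow_natCast, ← Real.rpow_mul (Nat.cast_nonneg _), hκn, hT',
        Real.mul_rpow (by positivity) hC₀0.le]
    calc (Dτ : ℝ) ^ (M + 3) ≤ (Cτ * (T : ℝ) ^ κ) ^ (M + 3) :=
          pow_le_pow_left₀ (Nat.cast_nonneg _) hDreal _
      _ = Cτ ^ (M + 3) * (2 * (V2 : ℝ)) ^ η * (C₀ : ℝ) ^ η := by rw [mul_pow, hTpow, mul_assoc]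
  -- the square-root lattice tool with host `z` at `H = {i₀}`, `i = i₁`
  have htool := sqrtLatticeToolZ hc₁ hc₂ hc₃ X Y Z hXp hYp hZp (hTval hvX) (hTval hvY) (hTval hvZ) hD
    ({i₀} : Finset (Fin M)) i₁ hi₁.ge
  obtain ⟨F, hF⟩ : ∃ F : ℕ, F = (subBox ({i₁} : Finset (Fin M)) X).card *
      (subBox ({i₁} : Finset (Fin M)) Y).card * (subBox ({i₀} : Finset (Fin M)) Z).card := ⟨_, rfl⟩
  obtain ⟨A, hAdef⟩ : ∃ A : ℕ, A = c₃ * offVal ({i₀} : Finset (Fin M)) Z := ⟨_, rfl⟩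
  have hi3 : (i₁ : ℕ) + 2 = 3 := by omega
  rw [← hF, ← hAdef, hi3] at htool
  have hA0 : 0 < A := by
    rw [hAdef]; exact Nat.mul_pos hc₃ (prod_pos fun j _ => pow_pos (hZp j) _)
  have hA' : (0 : ℝ) < A := by exact_mod_cast hA0
  have hX1 : (0 : ℝ) < X i₁ := by exact_mod_cast hXp i₁
  have hY1 : (0 : ℝ) < Y i₁ := by exact_mod_cast hYp i₁
  have hZ0 : (0 : ℝ) < Z i₀ := by exact_mod_cast hZp i₀
  -- name `P = ∏ XᵢYᵢZᵢ` and `R = C₀^{l-1+3ε}`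
  obtain ⟨P, hP⟩ : ∃ P : ℝ, P = ∏ i, ((X i : ℝ) * Y i * Z i) := ⟨_, rfl⟩
  obtain ⟨R, hR⟩ : ∃ R : ℝ, R = (C₀ : ℝ) ^ (l - 1 + 3 * ε) := ⟨_, rfl⟩
  have hR0 : 0 < R := by rw [hR]; positivity
  rw [← hP, ← hR] at hcert
  rw [← hP] at hPle
  -- `#fibres · Z₀X₁Y₁ = P`
  have hsub : ∀ (W : Fin M → ℕ) (j : Fin M),
      ((subBox ({j} : Finset (Fin M)) W).card : ℝ) * (W j : ℝ) = ∏ i, (W i : ℝ) := by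
    intro W j
    have h := card_subBox_mul ({j} : Finset (Fin M)) W
    rw [prod_singleton, card_dyadicBox] at h
    exact_mod_cast congrArg (Nat.cast (R := ℝ)) h
  have hFP : (F : ℝ) * ((Z i₀ : ℝ) * X i₁ * Y i₁) = P := by
    rw [hP, prod_mul_distrib, prod_mul_distrib, ← hsub X i₁, ← hsub Y i₁, ← hsub Z i₀, hF]
    push_cast; ring
  have hP0 : 0 ≤ P := by rw [← hFP]; positivity
  -- `A · Z₀ = c₃ · shapeVal Z ≥ C₀ / V₂`
  have hon : onVal ({i₀} : Finset (Fin M)) Z = Z i₀ := by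
    rw [onVal, prod_singleton, hi₀, zero_add, pow_one]
  have hAZ : (A : ℝ) * (Z i₀ : ℝ) = ((c₃ * shapeVal Z : ℕ) : ℝ) := by
    rw [hAdef, shapeVal_eq_offVal_mul_onVal ({i₀} : Finset (Fin M)) Z, hon]; push_cast; ring
  have hC₀A : (C₀ : ℝ) ≤ (V2 : ℝ) * ((A : ℝ) * Z i₀) := by
    rw [hAZ]; rw [← hV2] at hC₀le; exact_mod_cast hC₀le
  -- `(2C₀)^{l+3ε} = 2^{l+3ε} · R · C₀`
  have h2C₀ : (2 * C₀ : ℝ) ^ (l + 3 * ε) = (2 : ℝ) ^ (l + 3 * ε) * (R * C₀) := by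
    rw [Real.mul_rpow zero_le_two hC₀0.le, hR, ← Real.rpow_add_one hC₀0.ne',
      show l - 1 + 3 * ε + 1 = l + 3 * ε by ring]
  -- the two terms of the bracket: `#fibres ≤ 2R` and `#fibres · X₁Y₁/A ≤ V₂ 2^{l+3ε} R`
  have hF1 : (F : ℝ) ≤ 2 * R := by
    have hQ : (0 : ℝ) < (Z i₀ : ℝ) * X i₁ * Y i₁ := by positivity
    refine le_of_mul_le_mul_right ?_ hQ
    rw [hFP]; exact hcert
  have hF2 : (F : ℝ) * ((X i₁ : ℝ) * Y i₁) / A ≤ (V2 : ℝ) * (2 : ℝ) ^ (l + 3 * ε) * R := by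
    rw [div_le_iff₀ hA']
    have hZC : (0 : ℝ) < (Z i₀ : ℝ) * C₀ := by positivity
    refine le_of_mul_le_mul_right ?_ hZC
    calc (F : ℝ) * ((X i₁ : ℝ) * Y i₁) * ((Z i₀ : ℝ) * C₀) = P * C₀ := by rw [← hFP]; ring
      _ ≤ P * ((V2 : ℝ) * ((A : ℝ) * Z i₀)) := mul_le_mul_of_nonneg_left hC₀A hP0
      _ ≤ (2 * C₀ : ℝ) ^ (l + 3 * ε) * ((V2 : ℝ) * ((A : ℝ) * Z i₀)) :=
          mul_le_mul_of_nonneg_right hPle (by positivity)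
      _ = (V2 : ℝ) * (2 : ℝ) ^ (l + 3 * ε) * R * A * ((Z i₀ : ℝ) * C₀) := by rw [h2C₀]; ring
  have hbr : (F : ℝ) * (2 + 112 * ((X i₁ : ℝ) * Y i₁) / (A : ℝ)) ≤ E * R := by
    have e : (F : ℝ) * (2 + 112 * ((X i₁ : ℝ) * Y i₁) / (A : ℝ)) =
        2 * F + 112 * ((F : ℝ) * ((X i₁ : ℝ) * Y i₁) / A) := by ring
    rw [e, hE]
    linarith
  -- assemble
  calc (shapeCount c₁ c₂ c₃ X Y Z : ℝ)
        ≤ (F : ℝ) * (Dτ : ℝ) ^ (M + 3) * (2 + 112 * ((X i₁ : ℝ) * Y i₁) / (A : ℝ)) := htool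
    _ = (Dτ : ℝ) ^ (M + 3) * ((F : ℝ) * (2 + 112 * ((X i₁ : ℝ) * Y i₁) / (A : ℝ))) := by ring
    _ ≤ (Cτ ^ (M + 3) * (2 * (V2 : ℝ)) ^ η * (C₀ : ℝ) ^ η) * (E * R) :=
        mul_le_mul hDpow hbr (by positivity) (by positivity)
    _ = K * (R * (C₀ : ℝ) ^ η) := by rw [hK]; ring
    _ = K * (C₀ : ℝ) ^ (l - 1 + 3 * ε + η) := by rw [hR, ← Real.rpow_add hC₀0]

/-- **STUB 3b (`stub_twoRootTameZ`) of the line `critical-kloosterman-powerful-moduli`: the two-root tool with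
host `z` (the `c`-term) as a law.** For `1 < l < 2`, `0 < ε < 1/2`, `η > 0` there is `K` with
`B_M ≤ K C₀^{l-1+3ε+η}` (`M = numShapes ε`) on every admissible datum with
`∏ XᵢYᵢZᵢ ≤ 2 C₀^{l-1+3ε} · Z₀X₁Y₁`: the instance `M = numShapes ε` of `twoRootTameZ_law`. [folklore] -/
theorem stub_twoRootTameZ : ∀ l : ℝ, 1 < l → l < 2 → ∀ ε : ℝ, 0 < ε → ε < 1 / 2 → ∀ η : ℝ, 0 < η → ∃ K : ℝ, ∀ (C₀ c₁ c₂ c₃ : ℕ) (X Y Z : Fin (Literature.NumberTheory.DiophantineGeometry.AbcShapes.numShapes ε) → ℕ) (i₀ i₁ : Fin (Literature.NumberTheory.DiophantineGeometry.AbcShapes.numShapes ε)), (i₀ : ℕ) = 0 → (i₁ : ℕ) = 1 → Literature.NumberTheory.DiophantineGeometry.AbcShapes.Admissible l ε C₀ c₁ c₂ c₃ X Y Z → ((∏ i, ((X i : ℝ) * Y i * Z i)) ≤ 2 * (C₀ : ℝ) ^ (l - 1 + 3 * ε) * ((Z i₀ : ℝ) * X i₁ * Y i₁)) → (Literature.NumberTheory.DiophantineGeometry.AbcShapes.shapeCount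 c₁ c₂ c₃ X Y Z : ℝ) ≤ K * (C₀ : ℝ) ^ (l - 1 + 3 * ε + η) := by
  intro l _ _ ε _ _ η hη
  obtain ⟨K, -, hK⟩ := twoRootTameZ_law (numShapes ε) l ε hη
  exact ⟨K, hK⟩

end Summit.ABC.ABC.Theorems.MazurKaneLaw

end
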